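import Literature.Probability.RandomPlanarGeometry.JordanIndexOne
import Literature.Probability.RandomPlanarGeometry.CaratheodoryHalfPlane
import Literature.Probability.RandomPlanarGeometry.CritPercCardyFunctionProofs
import Mathlib.Analysis.SpecialFunctions.Trigonometric.Arctan
import HarnessLib

/-!
# Conformal maps onto positively oriented Jordan domains preserve the cyclic order of boundary points

Topic `Literature/Probability/RandomPlanarGeometry` (planar domains); theorems only. A sequel of
`JordanIndexOne.lean` (`JordanDomain.index`, `exists_lift`, `index_eq_mul_index`,
`wind_boundary_extension`: the Carathéodory boundary loop of a conformal map of the disc has index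
`1`) answering the recurring **orientation question** of the lattice-model statements that
uniformize a marked Jordan domain by the upper half-plane (`φ : ℍₒ → D` with boundary values the
marked points at real points `x₀ < x₁ < ⋯`; e.g. the four marked corners of Chelkak–Smirnov's
discrete quadrilaterals, `Literature.Probability.LatticeModels.ChelkakSmirnov2012_fkIsingQuadrilateralCrossing`,
whose hypothesis `StrictMono x ∨ StrictAnti x` has a geometrically vacuous branch):

* `cayleyFun_ofReal_eq_circleLoop` — the Cayley transform on the real axis is the circle loop
  read at the increasing parameter `θ(x) = 1/2 + arctan(x)/π ∈ (0, 1)`: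
  `cayleyFun x = e^{2πiθ(x)}`; so increasing real points go to anticlockwise-ordered points of
  the circle;
* `JordanDomain.exists_strictMono_boundary_params` — **if `D.index = 1` (the boundary loop
  `D.boundary` is anticlockwise) and `φ : ℍₒ → D` is a conformal equivalence with boundary values
  `p j` at strictly increasing real points `x j`, then `p j = D.boundary (s j)` for STRICTLY
  INCREASING parameters `s j` lying within one period (`s j < s i + 1`)**. Proof: by Carathéodory
  (`exists_continuousOn_extension_holds`) the frontier is also the loop `t ↦ Φ(e^{2πit})` of
  index `1` (`index_eq_one_of_boundary_eq`), which differs from `D.boundary` by a circle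
  homeomorphism `σ` of degree `index/index = +1` (`exists_lift`, `index_eq_mul_index`), i.e. an
  increasing one; and `p j = Φ(cayleyFun (x j)) = Φ(e^{2πiθ(x j)}) = D.boundary (σ (θ (x j)))`.

## References
* [PommerenkeBBCM1992] Ch. Pommerenke, *Boundary Behaviour of Conformal Maps* (1992), Thm. 2.6.
* [BollobasRiordan2006] B. Bollobás, O. Riordan, *Percolation* (2006), Ch. 7, Lemma 14 (the
  anticlockwise-order hypothesis this tool discharges).
-/

noncomputable section

open Set Filter Metric Topology Complex
open UpperHalfPlane (upperHalfPlaneSet)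
open Literature.Topology.PlaneTopology (circleLoop circleLoop_apply)

namespace Literature.Probability.RandomPlanarGeometry

/-! ### The Cayley transform on the real axis, as a circle parameter -/

/-- The circle parameter of the Cayley image of a real point: `θ(x) = 1/2 + arctan(x)/π`.
[folklore] -/
theorem cayleyParam_mem_Ioo (x : ℝ) : 1 / 2 + Real.arctan x / Real.pi ∈ Ioo (0 : ℝ) 1 := by
  have hπ := Real.pi_pos
  have h1 := Real.neg_pi_div_two_lt_arctan x
  have h2 := Real.arctan_lt_pi_div_two x
  constructor
  · have : -(1 / 2 : ℝ) < Real.arctan x / Real.pi := by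
      rw [lt_div_iff₀ hπ]; linarith
    linarith
  · have : Real.arctan x / Real.pi < 1 / 2 := by
      rw [div_lt_iff₀ hπ]; linarith
    linarith

/-- `θ(x) = 1/2 + arctan(x)/π` is strictly increasing. [folklore] -/
theorem strictMono_cayleyParam : StrictMono fun x : ℝ ↦ 1 / 2 + Real.arctan x / Real.pi :=
  fun _ _ h ↦ by
    simpa using (div_lt_div_iff_of_pos_right Real.pi_pos).2 (Real.arctan_strictMono h)

/-- **The Cayley transform on the real axis is the anticlockwise circle loop**:
`cayleyFun x = e^{2πiθ(x)}` with `θ(x) = 1/2 + arctan(x)/π` (both sides equal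
`((x² - 1) - 2ix)/(x² + 1)`). [folklore] -/
theorem cayleyFun_ofReal_eq_circleLoop (x : ℝ) :
    cayleyFun (x : ℂ) = circleLoop 0 1 (1 / 2 + Real.arctan x / Real.pi) := by
  rw [circleLoop_apply, cayleyFun_apply, zero_add, ofReal_one, one_mul]
  set α : ℝ := Real.arctan x with hα
  have hc2 : Real.cos α ^ 2 = 1 / (1 + x ^ 2) := Real.cos_sq_arctan x
  have hsc : Real.sin α * Real.cos α = x / (1 + x ^ 2) := by
    rw [hα, Real.sin_arctan, Real.cos_arctan, div_mul_div_comm, mul_one, ← sq,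
      Real.sq_sqrt (by positivity)]
  have harg : (2 * (Real.pi : ℂ) * ((1 / 2 + α / Real.pi : ℝ) : ℂ) * I) =
      (Real.pi : ℂ) * I + ((2 * α : ℝ) : ℂ) * I := by
    have hπ : (Real.pi : ℂ) ≠ 0 := by exact_mod_cast Real.pi_pos.ne'
    push_cast
    field_simp
  rw [harg, Complex.exp_add, Complex.exp_pi_mul_I, Complex.exp_mul_I, ← Complex.ofReal_cos,
    ← Complex.ofReal_sin, Real.cos_two_mul, Real.sin_two_mul, hc2,
    show 2 * Real.sin α * Real.cos α = 2 * (x / (1 + x ^ 2)) by rw [mul_assoc, hsc]]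
  have hxI : (x : ℂ) + I ≠ 0 := add_I_ne_zero (by simp)
  have hx2 : (1 : ℂ) + (x : ℂ) ^ 2 ≠ 0 := by
    have : (0 : ℝ) < 1 + x ^ 2 := by positivity
    exact_mod_cast this.ne'
  rw [div_eq_iff hxI]
  push_cast
  field_simp
  linear_combination (2 * (x : ℂ)) * Complex.I_sq

/-! ### Cyclic order of boundary values -/

namespace JordanDomain

/-- **A conformal map of `ℍₒ` onto a positively oriented Jordan domain preserves the cyclic order
of boundary points.** Let `D` be a Jordan domain whose boundary loop has index `1` (anticlockwise)
and `φ : ℍₒ → D` a conformal equivalence with boundary values `p j` at strictly increasing real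
points `x j`, `j < n`. Then there are strictly increasing parameters `s j`, all within one period
(`s j < s i + 1`), with `D.boundary (s j) = p j`: along `∂D` traversed by `D.boundary` the points
`p 0, p 1, …` come in this cyclic order. (Carathéodory, and comparison of the two boundary loops
of `D`: `exists_lift`, `index_eq_mul_index`, `index_eq_one_of_boundary_eq`.)
[cite: PommerenkeBBCM1992, Thm. 2.6; BollobasRiordan2006, Ch. 7 Lemma 14] -/
theorem exists_strictMono_boundary_params (D : JordanDomain) {z₀ : ℂ} (hz₀ : z₀ ∈ D.carrier)
    (hind : D.index z₀ = 1) (φ : ConformalEquiv upperHalfPlaneSet D.carrier) {n : ℕ}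
    {x : Fin n → ℝ} (hx : StrictMono x) {p : Fin n → ℂ}
    (hbv : ∀ j, φ.HasBoundaryValue (x j) (p j)) :
    ∃ s : Fin n → ℝ, StrictMono s ∧ (∀ j, D.boundary (s j) = p j) ∧ ∀ i j, s j < s i + 1 := by
  -- Carathéodory for the disc map `φD = φ ∘ cayley⁻¹`
  set φD := cayley.symm.trans φ with hφD
  obtain ⟨Φ, hΦc, hΦe, hbij, hbij'⟩ := exists_continuousOn_extension_holds D φD
  obtain ⟨D₂, hD₂, hD₂b⟩ := D.exists_ofDiscMap Φ hΦc hbij'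
  have h2 : D₂.index z₀ = 1 :=
    index_eq_one_of_boundary_eq D D₂ φD hΦc hΦe hbij.injOn hD₂ hD₂b hz₀
  -- the two boundary loops differ by an increasing circle homeomorphism
  obtain ⟨σ, hσc, hσ, hcase⟩ := exists_lift D₂ D hD₂
  have hzf : z₀ ∉ frontier D.carrier := fun h ↦
    (Set.disjoint_left.1 D.disjoint_carrier_frontier) hz₀ h
  have hmono : StrictMonoOn σ (Icc 0 1) ∧ σ 1 = σ 0 + 1 := by
    rcases hcase with h | ⟨-, h1⟩
    · exact h
    · exfalso
      have := index_eq_mul_index D₂ D hσc hσ (n := -1) (by rw [h1]; simp [sub_eq_add_neg]) hzf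
      rw [h2, hind] at this
      norm_num at this
  -- the parameters
  set θ : ℝ → ℝ := fun y ↦ 1 / 2 + Real.arctan y / Real.pi with hθ
  have hθI : ∀ y, θ y ∈ Icc (0 : ℝ) 1 := fun y ↦ Ioo_subset_Icc_self (cayleyParam_mem_Ioo y)
  refine ⟨fun j ↦ σ (θ (x j)), fun i j hij ↦ ?_, fun j ↦ ?_, fun i j ↦ ?_⟩
  · exact hmono.1 (hθI _) (hθI _) (strictMono_cayleyParam (hx hij))
  · show D.boundary (σ (θ (x j))) = p j
    rw [hσ _ (hθI _), hD₂b]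
    show Φ (circleLoop 0 1 (θ (x j))) = p j
    rw [hθ, ← cayleyFun_ofReal_eq_circleLoop]
    have hbvΦ : φ.HasBoundaryValue (x j) (Φ (cayleyFun (x j))) :=
      JordanDomain.tendsto_nhdsWithin_of_extension φ hΦc hΦe (x := x j) (by simp)
    exact hbvΦ.unique (hbv j)
  · show σ (θ (x j)) < σ (θ (x i)) + 1
    have h1 : σ (θ (x j)) < σ 1 :=
      hmono.1 (hθI _) (right_mem_Icc.2 zero_le_one) (cayleyParam_mem_Ioo _).2
    have h0 : σ 0 < σ (θ (x i)) :=
      hmono.1 (left_mem_Icc.2 zero_le_one) (hθI _) (cayleyParam_mem_Ioo _).1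
    linarith [hmono.2]

/-- **Corollary: no conformal map realises the reversed cyclic order.** If `D.index = 1` and the
four points `D.boundary (s j)`, `s 0 < s 1 < s 2 < s 3 < s 0 + 1` (anticlockwise), are the
boundary values of a conformal map `φ : ℍₒ → D` at real points `x j`, then `x` is not strictly
antitone. [cite: PommerenkeBBCM1992, Thm. 2.6] -/
theorem not_strictAnti_of_hasBoundaryValue (D : JordanDomain) {z₀ : ℂ} (hz₀ : z₀ ∈ D.carrier)
    (hind : D.index z₀ = 1) (φ : ConformalEquiv upperHalfPlaneSet D.carrier) {s : Fin 4 → ℝ}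
    (hs : StrictMono s) (hs1 : s 3 < s 0 + 1) {x : Fin 4 → ℝ}
    (hbv : ∀ j, φ.HasBoundaryValue (x j) (D.boundary (s j))) : ¬ StrictAnti x := by
  intro hx
  -- reversed labels are increasing; get increasing parameters `s'` for the reversed points
  have hx' : StrictMono (x ∘ Fin.rev) := fun i j hij ↦ hx (Fin.rev_lt_rev.2 hij)
  obtain ⟨s', hs'm, hs'b, hs'1⟩ := D.exists_strictMono_boundary_params hz₀ hind φ hx'
    (p := fun j ↦ D.boundary (s (Fin.rev j))) (fun j ↦ hbv (Fin.rev j))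
  -- `s' j ≡ s (rev j) (mod 1)`
  have hk : ∀ j : Fin 4, ∃ k : ℤ, s' j = s (Fin.rev j) + k := fun j ↦ by
    obtain ⟨k, hk⟩ := D.exists_int_of_boundary_eq (hs'b j)
    exact ⟨k, hk⟩
  obtain ⟨k0, hk0⟩ := hk 0
  obtain ⟨k1, hk1⟩ := hk 1
  obtain ⟨k2, hk2⟩ := hk 2
  obtain ⟨k3, hk3⟩ := hk 3
  have e0 : Fin.rev (0 : Fin 4) = 3 := rfl
  have e1 : Fin.rev (1 : Fin 4) = 2 := rfl
  have e2 : Fin.rev (2 : Fin 4) = 1 := rfl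
  have e3 : Fin.rev (3 : Fin 4) = 0 := rfl
  rw [e0] at hk0; rw [e1] at hk1; rw [e2] at hk2; rw [e3] at hk3
  -- s' 0 < s' 1 < s' 2 < s' 3 < s' 0 + 1 with s' 0 = s 3 + k0, s' 1 = s 2 + k1, s' 2 = s 1 + k2, s' 3 = s 0 + k3
  have a01 : s' 0 < s' 1 := hs'm (by decide)
  have a12 : s' 1 < s' 2 := hs'm (by decide)
  have a23 : s' 2 < s' 3 := hs'm (by decide)
  have a30 : s' 3 < s' 0 + 1 := hs'1 0 3
  have b01 : s 0 < s 1 := hs (by decide)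
  have b12 : s 1 < s 2 := hs (by decide)
  have b23 : s 2 < s 3 := hs (by decide)
  -- integer bookkeeping: from a01: s 3 + k0 < s 2 + k1, with s 2 < s 3: k0 < k1, so k0 + 1 ≤ k1;
  -- similarly k1 + 1 ≤ k2, k2 + 1 ≤ k3; and a30: s 0 + k3 < s 3 + k0 + 1 with s 3 < s 0 + 1:
  -- k3 < k0 + 2, i.e. k3 ≤ k0 + 1: contradiction with k3 ≥ k0 + 3.
  have i1 : k0 + 1 ≤ k1 := by
    have : (k0 : ℝ) < k1 := by linarith
    exact_mod_cast (show k0 < k1 by exact_mod_cast this)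
  have i2 : k1 + 1 ≤ k2 := by
    have : (k1 : ℝ) < k2 := by linarith
    exact_mod_cast (show k1 < k2 by exact_mod_cast this)
  have i3 : k2 + 1 ≤ k3 := by
    have : (k2 : ℝ) < k3 := by linarith
    exact_mod_cast (show k2 < k3 by exact_mod_cast this)
  have i4 : k3 ≤ k0 + 1 := by
    have : (k3 : ℝ) < k0 + 2 := by linarith
    have : k3 < k0 + 2 := by exact_mod_cast this
    omega
  omega

end JordanDomain

end Literature.Probability.RandomPlanarGeometry
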